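import Summits.ABC.ABC.Theses.IneffectiveSubspace
import Literature.NumberTheory.DiophantineApproximation.RidoutIntegers
import Literature.NumberTheory.DiophantineApproximation.RidoutRationalsClass
import Literature.NumberTheory.DiophantineApproximation.RidoutRationals
import Summits.ABC.ABC.Theorems.IneffectiveSubspaceDeepRegimeABCStubZeroIntOfRat
import Summits.ABC.ABC.Theorems.IneffectiveSubspaceDeepRegimeABCStubCoreBound
import Summits.ABC.ABC.Theorems.IneffectiveSubspaceDeepRegimeABCStubRoughReduction

/-!
# Crux `DeepRegimeABC` (stmt-ABC-15121) — line `SketchIdeator5R2` (card `ridout-core-exhaustion`),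
# lead's skeleton (prover-line-stmt-ABC-15121-a1-0)

Composition (`DeepRegimeABC_of`, proved modulo the `stub_*` theorems):

* `stub_ridoutClassFalse` — Ridout's class contradiction over `ℚ` with a PARTIAL archimedean share
  `|ρ| ≤ c₀·den(ρ)^{-μ}` (generalises the tree's `Ridout.false_of_class`, which is the case `μ = 1`);
* `stub_ridoutRat` — Bombieri–Gubler Thm. 6.2.3 for `K = ℚ`, `α_∞ = 0`, `|β| ≤ 1`, from the class
  contradiction (Mahler's classes with the archimedean place as one more coordinate);
* `stub_zeroInt_of_rat` — the same theorem for INTEGER targets in the `padicNorm` vocabulary (lead);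
* `stub_coreBound` — `RidoutCoreBound` (cored abc triples are bounded) from it, by the Möbius
  transformation `β ↦ (1+t)β/(β+t)`, `t = y!`, one target pattern at a time;
* `stub_roughReduction` — `RoughPowerfulTailABC → CorelessTailABC` (mass bookkeeping);
* `stub_roughPowerfulTail` — the OPEN stub (lead): abc(1+ε) on the deep tail for triples whose
  `y`-rough powerful excess is `≥ θ·log c`;
* `deepRegimeABC_of_coreless : RidoutCoreBound → CorelessTailABC → DeepRegimeABC` (planners, proved).
-/

set_option linter.dupNamespace false

namespace Summit.ABC.ABC.Cruxes.DeepRegimeABC.RidoutCore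

open Literature.NumberTheory.DiophantineGeometry UniqueFactorizationMonoid
open Summit.ABC.ABC.Theses.IneffectiveSubspace
open scoped Polynomial

/-! ## Definitions (glue only — every `stub_*` below is stated with these unfolded) -/

/-- The depth-5 count `ω₅(abc) = #{p : p⁵ ∣ abc}` exactly as in the crux. -/
noncomputable def depth5 (a b c : ℕ) : ℕ :=
  ((a * b * c).primeFactors.filter (fun p => 5 ≤ (a * b * c).factorization p)).card

/-- Ridout CORE MASS of `(a,b,c)` on the places `{p ≤ y} ∪ {∞}`:
`M_y(a,b,c) = Σ_{p ≤ y, p ∣ abc} v_p(abc)·log p + log (c / min(a,b))`. -/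
noncomputable def coreMass (y : ℕ) (a b c : ℕ) : ℝ :=
  (∑ p ∈ (a * b * c).primeFactors.filter (fun p => p ≤ y),
      ((a * b * c).factorization p : ℝ) * Real.log p)
    + Real.log ((c : ℝ) / ((min a b : ℕ) : ℝ))

/-- The `y`-ROUGH mass of `abc`: `Σ_{p > y, p ∣ abc} v_p(abc)·log p`. -/
noncomputable def roughMass (y : ℕ) (a b c : ℕ) : ℝ :=
  ∑ p ∈ (a * b * c).primeFactors.filter (fun p => ¬ p ≤ y),
      ((a * b * c).factorization p : ℝ) * Real.log p

/-- The `y`-ROUGH POWERFUL EXCESS of `abc`: `Σ_{p > y, p ∣ abc} (v_p(abc) − 1)·log p`. -/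
noncomputable def roughExcess (y : ℕ) (a b c : ℕ) : ℝ :=
  ∑ p ∈ (a * b * c).primeFactors.filter (fun p => ¬ p ≤ y),
      (((a * b * c).factorization p : ℝ) - 1) * Real.log p

/-- **RidoutCoreBound**: for every `y` and `δ > 0` the abc triples with core mass
`M_y(a,b,c) ≥ (2+δ)·log c` are bounded. -/
def RidoutCoreBound : Prop :=
  ∀ y : ℕ, ∀ δ : ℝ, 0 < δ → ∃ B : ℝ, ∀ a b c : ℕ, IsABCTriple a b c →
    (2 + δ) * Real.log c ≤ coreMass y a b c → (c : ℝ) ≤ B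

/-- **CorelessTailABC**: the crux for CORELESS triples only (`M_y < (2+δ) log c`), the prover choosing
`y, δ` as functions of `ε`. -/
def CorelessTailABC : Prop :=
  ∀ ε : ℝ, 0 < ε → ∃ y : ℕ, ∃ δ : ℝ, 0 < δ ∧ ∃ K : ℕ, ∃ C : ℝ, 0 < C ∧
    ∀ a b c : ℕ, IsABCTriple a b c → K ≤ depth5 a b c →
      coreMass y a b c < (2 + δ) * Real.log c →
      (c : ℝ) < C * ((rad a b c : ℕ) : ℝ) ^ (1 + ε)

/-- **RoughPowerfulTailABC** (the open stub): abc with exponent `1+ε` on the deep tail `{ω₅ ≥ K}` for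
triples whose `y`-rough powerful excess is at least `θ·log c`, for every `θ < ε/(1+ε)`, the prover
choosing `y, K, C`. -/
def RoughPowerfulTailABC : Prop :=
  ∀ ε : ℝ, 0 < ε → ∀ θ : ℝ, 0 < θ → θ * (1 + ε) < ε → ∃ y : ℕ, ∃ K : ℕ, ∃ C : ℝ, 0 < C ∧
    ∀ a b c : ℕ, IsABCTriple a b c → K ≤ depth5 a b c →
      θ * Real.log c ≤ roughExcess y a b c →
      (c : ℝ) < C * ((rad a b c : ℕ) : ℝ) ^ (1 + ε)

/-- **RidoutZeroInt**: Ridout's theorem over `ℚ` with the archimedean target `0` (partial share allowed)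
and INTEGER `p`-adic targets, for rationals of absolute value `≤ 1`, in the `padicNorm` vocabulary:
for `κ > 2` only finitely many `ρ`, `|ρ| ≤ 1`, have `|ρ|·Π_{p∈S} min(1,|ρ − k_p|_p) ≤ den(ρ)^{-κ}`. -/
def RidoutZeroInt : Prop :=
  ∀ (S : Finset ℕ), (∀ p ∈ S, p.Prime) → ∀ (k : ℕ → ℤ) (κ : ℝ), 2 < κ →
    {ρ : ℚ | |(ρ : ℝ)| ≤ 1 ∧
      |(ρ : ℝ)| * (∏ p ∈ S, min (1 : ℝ) ((padicNorm p (ρ - k p) : ℚ) : ℝ)) ≤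
        (ρ.den : ℝ) ^ (-κ)}.Finite

/-! ## Mass bookkeeping (planners' sketch, proved) -/

/-- `log n = Σ_{p ∣ n} v_p(n) log p`. -/
theorem log_eq_sum_factorization {n : ℕ} (hn : n ≠ 0) :
    Real.log n = ∑ p ∈ n.primeFactors, (n.factorization p : ℝ) * Real.log p := by
  have hprod : (n : ℝ) = ∏ p ∈ n.primeFactors, ((p : ℝ) ^ (n.factorization p)) := by
    conv_lhs => rw [← Nat.prod_factorization_pow_eq_self hn]
    rw [Finsupp.prod, Nat.support_factorization]
    push_cast
    rfl
  rw [hprod, Real.log_prod]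
  · refine Finset.sum_congr rfl fun p _ => ?_
    rw [Real.log_pow]
  · intro p hp
    have hp0 : (p : ℝ) ≠ 0 := by exact_mod_cast (Nat.prime_of_mem_primeFactors hp).ne_zero
    exact pow_ne_zero _ hp0

/-- Core + rough = total: `M_y + R_y = log(abc) + log(c / min(a,b))`. -/
theorem coreMass_add_roughMass (y a b c : ℕ) (habc : a * b * c ≠ 0) :
    coreMass y a b c + roughMass y a b c =
      Real.log ((a * b * c : ℕ) : ℝ) + Real.log ((c : ℝ) / ((min a b : ℕ) : ℝ)) := by
  unfold coreMass roughMass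
  rw [log_eq_sum_factorization habc, add_right_comm,
    Finset.sum_filter_add_sum_filter_not]

/-- **Coreless ⟹ rough-heavy.** For an abc triple with core mass `< (2+δ)·log c` the `y`-rough part of
`abc` carries more than `(1-δ)·log c - log 2`:  `R_y > (1-δ) log c - log 2`. -/
theorem roughMass_gt_of_coreless {y a b c : ℕ} {δ : ℝ} (habc : IsABCTriple a b c)
    (hcore : coreMass y a b c < (2 + δ) * Real.log c) :
    (1 - δ) * Real.log c - Real.log 2 < roughMass y a b c := by
  obtain ⟨ha, hb, hsum, -⟩ := habc
  have hc : 0 < c := by omega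
  have habc0 : a * b * c ≠ 0 := by positivity
  have hid := coreMass_add_roughMass y a b c habc0
  have hmin0 : (0 : ℝ) < ((min a b : ℕ) : ℝ) := by exact_mod_cast lt_min ha hb
  have hmax0 : (0 : ℝ) < ((max a b : ℕ) : ℝ) := by exact_mod_cast lt_max_of_lt_left ha
  have hcR : (0 : ℝ) < (c : ℝ) := by exact_mod_cast hc
  set m : ℝ := ((min a b : ℕ) : ℝ) with hm
  set M : ℝ := ((max a b : ℕ) : ℝ) with hM
  have hminmax : m * M = (a : ℝ) * b := by
    rcases le_total a b with h | h
    · simp [hm, hM, min_eq_left h, max_eq_right h]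
    · simp [hm, hM, min_eq_right h, max_eq_left h, mul_comm]
  have habcR : ((a * b * c : ℕ) : ℝ) = (a : ℝ) * b * c := by push_cast; ring
  have hkey : Real.log ((a * b * c : ℕ) : ℝ) + Real.log ((c : ℝ) / m) =
      Real.log M + 2 * Real.log c := by
    have hprod : ((a * b * c : ℕ) : ℝ) * ((c : ℝ) / m) = M * (c : ℝ) ^ 2 := by
      rw [habcR, ← hminmax]
      field_simp
    rw [← Real.log_mul (by positivity) (by positivity), hprod,
      Real.log_mul (by positivity) (by positivity), Real.log_pow]
    push_cast
    ring
  have hmaxge : (c : ℝ) / 2 ≤ ((max a b : ℕ) : ℝ) := by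
    have : (c : ℝ) ≤ 2 * ((max a b : ℕ) : ℝ) := by
      have h1 : (a : ℝ) ≤ ((max a b : ℕ) : ℝ) := by exact_mod_cast le_max_left a b
      have h2 : (b : ℝ) ≤ ((max a b : ℕ) : ℝ) := by exact_mod_cast le_max_right a b
      have h3 : (c : ℝ) = a + b := by exact_mod_cast hsum.symm
      linarith
    linarith
  have hlogmax : Real.log c - Real.log 2 ≤ Real.log ((max a b : ℕ) : ℝ) := by
    rw [← Real.log_div hcR.ne' (by norm_num)]
    exact Real.log_le_log (by positivity) hmaxge
  linarith [hid, hkey, hlogmax]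

/-- `rad(abc)^(1+ε) ≥ 1`. -/
theorem one_le_rad_rpow (a b c : ℕ) {ε : ℝ} (hε : 0 < ε) :
    (1 : ℝ) ≤ ((rad a b c : ℕ) : ℝ) ^ (1 + ε) := by
  have h1 : (1 : ℝ) ≤ ((rad a b c : ℕ) : ℝ) := by
    rw [rad_def]
    exact_mod_cast Nat.pos_of_ne_zero radical_ne_zero
  exact Real.one_le_rpow h1 (by linarith)

/-- **The line's composition (planners, PROVED):** fixed-place Ridout + the coreless tail give the crux,
by a case split on the core mass and absorption of the bounded (cored) triples into the constant. -/
theorem deepRegimeABC_of_coreless (hR : RidoutCoreBound) (hC : CorelessTailABC) :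
    Summit.ABC.ABC.Theses.IneffectiveSubspace.DeepRegimeABC := by
  intro ε hε
  obtain ⟨y, δ, hδ, K, C, hC0, h⟩ := hC ε hε
  obtain ⟨B, hB⟩ := hR y δ hδ
  refine ⟨K, max C (B + 1), lt_max_of_lt_left hC0, fun a b c habc hK => ?_⟩
  have hrad1 : (1 : ℝ) ≤ ((rad a b c : ℕ) : ℝ) ^ (1 + ε) := one_le_rad_rpow a b c hε
  have hrad0 : (0 : ℝ) ≤ ((rad a b c : ℕ) : ℝ) ^ (1 + ε) := le_trans zero_le_one hrad1
  have hmax0 : (0 : ℝ) ≤ max C (B + 1) := le_trans hC0.le (le_max_left _ _)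
  by_cases hcore : coreMass y a b c < (2 + δ) * Real.log c
  · calc (c : ℝ) < C * ((rad a b c : ℕ) : ℝ) ^ (1 + ε) := h a b c habc hK hcore
      _ ≤ max C (B + 1) * ((rad a b c : ℕ) : ℝ) ^ (1 + ε) :=
          mul_le_mul_of_nonneg_right (le_max_left _ _) hrad0
  · have hcB : (c : ℝ) ≤ B := hB a b c habc (not_lt.mp hcore)
    calc (c : ℝ) ≤ B := hcB
      _ < B + 1 := by linarith
      _ ≤ max C (B + 1) := le_max_right _ _
      _ = max C (B + 1) * 1 := (mul_one _).symm
      _ ≤ max C (B + 1) * ((rad a b c : ℕ) : ℝ) ^ (1 + ε) :=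
          mul_le_mul_of_nonneg_left hrad1 hmax0

/-- The trivial direction: the crux implies its coreless form (ignore the extra hypothesis). -/
theorem corelessTailABC_of_deepRegimeABC
    (h : Summit.ABC.ABC.Theses.IneffectiveSubspace.DeepRegimeABC) : CorelessTailABC := by
  intro ε hε
  obtain ⟨K, C, hC, hK⟩ := h ε hε
  exact ⟨2, 1, one_pos, K, C, hC, fun a b c habc hKle _ => hK a b c habc hKle⟩

/-- The trivial direction for the open stub: the crux implies `RoughPowerfulTailABC`. -/
theorem roughPowerfulTailABC_of_deepRegimeABC
    (h : Summit.ABC.ABC.Theses.IneffectiveSubspace.DeepRegimeABC) : RoughPowerfulTailABC := by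
  intro ε hε θ _ _
  obtain ⟨K, C, hC, hK⟩ := h ε hε
  exact ⟨0, K, C, hC, fun a b c habc hKle _ => hK a b c habc hKle⟩

/-! ## The stubs (registered signatures; `sorry` only here) -/

/-- **S1 — Ridout's class contradiction with a partial archimedean share** (B–G 6.2.9/§6.4 over `ℚ`,
targets `θ_p` roots of monic `Q_p ∈ ℤ[X]` at `p ∈ S` and `0` at `∞`): there is no unlimited supply of
rationals `ρ` with `|ρ| ≤ c₀·den(ρ)^{-μ}` and `min(1,|ρ − θ_p|_p) ≤ den(ρ)^{-ν_p}` when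
`μ + Σ_p ν_p ≥ 2 + ε/2`.  The tree's `Ridout.false_of_class` is the case `μ = 1`, `ν_p = (1+ε)λ_p`. -/
theorem stub_ridoutClassFalse (S : Finset Nat.Primes) (Q : Nat.Primes → ℤ[X])
    (hQm : ∀ p ∈ S, (Q p).Monic) (hQd : ∀ p ∈ S, 1 ≤ (Q p).natDegree)
    (θ : ∀ p : Nat.Primes, @PadicAlgCl (p : ℕ) ⟨p.2⟩)
    (hθ : ∀ p ∈ S, Polynomial.aeval (θ p) (Q p) = 0)
    (c₀ : ℕ) (hc₀ : 1 ≤ c₀) {ε : ℝ} (hε : 0 < ε)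
    (μ : ℝ) (hμ : 0 ≤ μ) (ν : Nat.Primes → ℝ) (hν : ∀ p, 0 ≤ ν p)
    (hsum : 2 + ε / 2 ≤ μ + ∑ p ∈ S, ν p)
    (hsupply : ∀ N : ℕ, ∃ ρ : ℚ, N < ρ.den ∧ (|(ρ : ℝ)| ≤ c₀ * (ρ.den : ℝ) ^ (-μ) ∧
      ∀ p ∈ S, min 1 ‖(ρ : @PadicAlgCl (p : ℕ) ⟨p.2⟩) - θ p‖ ≤ (ρ.den : ℝ) ^ (-(ν p)))) :
    False :=
  -- LANDED (wave 1, S1): p104906, Literature/NumberTheory/DiophantineApproximation/RidoutRationalsClass.lean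
  Literature.NumberTheory.DiophantineApproximation.Ridout.false_of_class_abs S Q hQm hQd θ hθ c₀ hc₀ hε
    μ hμ ν hν hsum hsupply

/-- **S2 — Bombieri–Gubler Thm. 6.2.3 for `K = ℚ`, `α_∞ = 0`, `|β| ≤ 1`, from the class contradiction**:
for `κ > 2` only finitely many rationals `ρ` with `|ρ| ≤ 1` satisfy
`|ρ| · Π_{p∈S} min(1,|ρ − θ_p|_p) ≤ den(ρ)^{-κ}`. -/
theorem stub_ridoutRat (S : Finset Nat.Primes) (Q : Nat.Primes → ℤ[X])
    (hQm : ∀ p ∈ S, (Q p).Monic) (hQd : ∀ p ∈ S, 1 ≤ (Q p).natDegree)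
    (θ : ∀ p : Nat.Primes, @PadicAlgCl (p : ℕ) ⟨p.2⟩)
    (hθ : ∀ p ∈ S, Polynomial.aeval (θ p) (Q p) = 0) {κ : ℝ} (hκ : 2 < κ)
    (hClass : ∀ (c₀ : ℕ), 1 ≤ c₀ → ∀ (ε : ℝ), 0 < ε → ∀ (μ : ℝ), 0 ≤ μ →
      ∀ (ν : Nat.Primes → ℝ), (∀ p, 0 ≤ ν p) → 2 + ε / 2 ≤ μ + ∑ p ∈ S, ν p →
      (∀ N : ℕ, ∃ ρ : ℚ, N < ρ.den ∧ (|(ρ : ℝ)| ≤ c₀ * (ρ.den : ℝ) ^ (-μ) ∧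
        ∀ p ∈ S, min 1 ‖(ρ : @PadicAlgCl (p : ℕ) ⟨p.2⟩) - θ p‖ ≤ (ρ.den : ℝ) ^ (-(ν p)))) →
      False) :
    {ρ : ℚ | |(ρ : ℝ)| ≤ 1 ∧
      |(ρ : ℝ)| * (∏ p ∈ S, min (1 : ℝ) ‖(ρ : @PadicAlgCl (p : ℕ) ⟨p.2⟩) - θ p‖) ≤
        (ρ.den : ℝ) ^ (-κ)}.Finite :=
  -- LANDED (wave 1, S2): p104966, Literature/NumberTheory/DiophantineApproximation/RidoutRationals.lean
  Literature.NumberTheory.DiophantineApproximation.Ridout.finite_of_abs_le_one_of_class S Q hQm hQd θ hθ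
    hκ hClass

/-- **S2′ (lead) — the integer-target, `padicNorm` form** of S1+S2: `RidoutZeroInt` from the
`PadicAlgCl`-form finiteness theorem for the monic degree-one targets `X − k_p`. -/
theorem stub_zeroInt_of_rat
    (hRat : ∀ (S : Finset Nat.Primes) (Q : Nat.Primes → ℤ[X]),
      (∀ p ∈ S, (Q p).Monic) → (∀ p ∈ S, 1 ≤ (Q p).natDegree) →
      ∀ (θ : ∀ p : Nat.Primes, @PadicAlgCl (p : ℕ) ⟨p.2⟩),
      (∀ p ∈ S, Polynomial.aeval (θ p) (Q p) = 0) → ∀ (κ : ℝ), 2 < κ →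
      {ρ : ℚ | |(ρ : ℝ)| ≤ 1 ∧
        |(ρ : ℝ)| * (∏ p ∈ S, min (1 : ℝ) ‖(ρ : @PadicAlgCl (p : ℕ) ⟨p.2⟩) - θ p‖) ≤
          (ρ.den : ℝ) ^ (-κ)}.Finite) :
    ∀ (S : Finset ℕ), (∀ p ∈ S, p.Prime) → ∀ (k : ℕ → ℤ) (κ : ℝ), 2 < κ →
      {ρ : ℚ | |(ρ : ℝ)| ≤ 1 ∧
        |(ρ : ℝ)| * (∏ p ∈ S, min (1 : ℝ) ((padicNorm p (ρ - k p) : ℚ) : ℝ)) ≤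
          (ρ.den : ℝ) ^ (-κ)}.Finite :=
  -- LANDED (wave 1, S2′): p105139, Theorems/IneffectiveSubspaceDeepRegimeABCStubZeroIntOfRat.lean
  Summit.ABC.ABC.Theorems.DeepRegimeABC.stub_zeroInt_of_rat hRat

/-- **S3 — RidoutCoreBound from Ridout's theorem** (`RidoutZeroInt → RidoutCoreBound`, unfolded): for a
cored triple with `a = min(a,b)` put `t = y!`, `ρ = (1+t)a/(a+tc) ∈ (0,1]`; then `den ρ ≤ (1+t)c`,
`|ρ| ≤ 2a/c`, and at `p ≤ y`: `min(1,|ρ|_p) ≤ p^{v_p(t)}|a|_p` (`p ∣ a`), `|ρ − 1|_p ≤ |b|_p` (`p ∣ b`),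
`|ρ − (1+t)|_p ≤ |c|_p` (`p ∣ c`), so `|ρ|·Π min(1,|ρ − k_p|_p) ≤ 2t·e^{-M_y} ≤ 2t(1+t)^{2+δ} den^{-(2+δ)}`;
one application of the hypothesis per target pattern (`κ = 2 + δ/2`) plus the finitely many small
denominators bound `den ρ`, hence `c ≤ (1+t)·den ρ`. -/
theorem stub_coreBound
    (hR : ∀ (S : Finset ℕ), (∀ p ∈ S, p.Prime) → ∀ (k : ℕ → ℤ) (κ : ℝ), 2 < κ →
      {ρ : ℚ | |(ρ : ℝ)| ≤ 1 ∧
        |(ρ : ℝ)| * (∏ p ∈ S, min (1 : ℝ) ((padicNorm p (ρ - k p) : ℚ) : ℝ)) ≤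
          (ρ.den : ℝ) ^ (-κ)}.Finite) :
    ∀ y : ℕ, ∀ δ : ℝ, 0 < δ → ∃ B : ℝ, ∀ a b c : ℕ, IsABCTriple a b c →
      (2 + δ) * Real.log c ≤
        (∑ p ∈ (a * b * c).primeFactors.filter (fun p => p ≤ y),
            ((a * b * c).factorization p : ℝ) * Real.log p)
          + Real.log ((c : ℝ) / ((min a b : ℕ) : ℝ)) →
      (c : ℝ) ≤ B :=
  -- LANDED (wave 1, S3): p105815, Theorems/IneffectiveSubspaceDeepRegimeABCStubCoreBound.lean
  Summit.ABC.ABC.Theorems.DeepRegimeABC.stub_coreBound hR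

/-- **S4 — the rough reduction** (`RoughPowerfulTailABC → CorelessTailABC`, unfolded): given `ε`, take
`θ = ε/(2(1+ε))`, the stub's `y, K, C`, `δ = (ε/(1+ε) − θ)/2`; a coreless triple violating
`c < C'·rad^{1+ε}` (`C' = max C c₀ ≥ 1`) has `Σ_{p>y, p∣abc} log p ≤ log rad ≤ log c/(1+ε)` and rough mass
`> (1−δ) log c − log 2`, hence rough powerful excess `≥ θ log c` once `c ≥ c₀(ε)`. -/
theorem stub_roughReduction
    (hT : ∀ ε : ℝ, 0 < ε → ∀ θ : ℝ, 0 < θ → θ * (1 + ε) < ε → ∃ y : ℕ, ∃ K : ℕ, ∃ C : ℝ, 0 < C ∧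
      ∀ a b c : ℕ, IsABCTriple a b c →
        K ≤ ((a * b * c).primeFactors.filter (fun p => 5 ≤ (a * b * c).factorization p)).card →
        θ * Real.log c ≤
          ∑ p ∈ (a * b * c).primeFactors.filter (fun p => ¬ p ≤ y),
            (((a * b * c).factorization p : ℝ) - 1) * Real.log p →
        (c : ℝ) < C * ((rad a b c : ℕ) : ℝ) ^ (1 + ε)) :
    ∀ ε : ℝ, 0 < ε → ∃ y : ℕ, ∃ δ : ℝ, 0 < δ ∧ ∃ K : ℕ, ∃ C : ℝ, 0 < C ∧
      ∀ a b c : ℕ, IsABCTriple a b c →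
        K ≤ ((a * b * c).primeFactors.filter (fun p => 5 ≤ (a * b * c).factorization p)).card →
        (∑ p ∈ (a * b * c).primeFactors.filter (fun p => p ≤ y),
              ((a * b * c).factorization p : ℝ) * Real.log p)
            + Real.log ((c : ℝ) / ((min a b : ℕ) : ℝ)) < (2 + δ) * Real.log c →
        (c : ℝ) < C * ((rad a b c : ℕ) : ℝ) ^ (1 + ε) :=
  -- LANDED (wave 1, S4): p106554, Theorems/IneffectiveSubspaceDeepRegimeABCStubRoughReduction.lean
  Summit.ABC.ABC.Theorems.DeepRegimeABC.stub_roughReduction hT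

/-- **S5 — the OPEN stub (lead): `RoughPowerfulTailABC`**, unfolded.  abc with exponent `1+ε` on the
deep tail `{ω₅(abc) ≥ K}` for triples whose `y`-rough powerful excess `Σ_{p>y}(v_p(abc)−1) log p` is at
least `θ·log c` (`0 < θ < ε/(1+ε)`), with `y, K, C` free.  Equivalent to the crux modulo S1–S4
(`roughPowerfulTailABC_of_deepRegimeABC` for the converse). -/
theorem stub_roughPowerfulTail :
    ∀ ε : ℝ, 0 < ε → ∀ θ : ℝ, 0 < θ → θ * (1 + ε) < ε → ∃ y : ℕ, ∃ K : ℕ, ∃ C : ℝ, 0 < C ∧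
      ∀ a b c : ℕ, IsABCTriple a b c →
        K ≤ ((a * b * c).primeFactors.filter (fun p => 5 ≤ (a * b * c).factorization p)).card →
        θ * Real.log c ≤
          ∑ p ∈ (a * b * c).primeFactors.filter (fun p => ¬ p ≤ y),
            (((a * b * c).factorization p : ℝ) - 1) * Real.log p →
        (c : ℝ) < C * ((rad a b c : ℕ) : ℝ) ^ (1 + ε) := by
  sorry

/-! ## Composition -/

/-- B–G Thm. 6.2.3 (`K = ℚ`, `α_∞ = 0`, `|β| ≤ 1`): S2 fed with S1. -/
theorem ridoutRat (S : Finset Nat.Primes) (Q : Nat.Primes → ℤ[X])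
    (hQm : ∀ p ∈ S, (Q p).Monic) (hQd : ∀ p ∈ S, 1 ≤ (Q p).natDegree)
    (θ : ∀ p : Nat.Primes, @PadicAlgCl (p : ℕ) ⟨p.2⟩)
    (hθ : ∀ p ∈ S, Polynomial.aeval (θ p) (Q p) = 0) (κ : ℝ) (hκ : 2 < κ) :
    {ρ : ℚ | |(ρ : ℝ)| ≤ 1 ∧
      |(ρ : ℝ)| * (∏ p ∈ S, min (1 : ℝ) ‖(ρ : @PadicAlgCl (p : ℕ) ⟨p.2⟩) - θ p‖) ≤
        (ρ.den : ℝ) ^ (-κ)}.Finite :=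
  stub_ridoutRat S Q hQm hQd θ hθ hκ (fun c₀ hc₀ _ε hε μ hμ ν hν hsum hsupply =>
    stub_ridoutClassFalse S Q hQm hQd θ hθ c₀ hc₀ hε μ hμ ν hν hsum hsupply)

/-- `RidoutZeroInt` holds (S1 + S2 + S2′). -/
theorem ridoutZeroInt : RidoutZeroInt :=
  stub_zeroInt_of_rat ridoutRat

/-- `RidoutCoreBound` holds (S3 on top of `ridoutZeroInt`). -/
theorem ridoutCoreBound : RidoutCoreBound :=
  stub_coreBound ridoutZeroInt

/-- `CorelessTailABC` from the open stub (S4 ∘ S5). -/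
theorem corelessTailABC : CorelessTailABC :=
  stub_roughReduction stub_roughPowerfulTail

/-- **The crux, modulo the stubs.** -/
theorem DeepRegimeABC_of : Summit.ABC.ABC.Theses.IneffectiveSubspace.DeepRegimeABC :=
  deepRegimeABC_of_coreless ridoutCoreBound corelessTailABC

end Summit.ABC.ABC.Cruxes.DeepRegimeABC.RidoutCore
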